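/-
VALUE = THEOREM, NOT summit progress (cell b2b-lgcu-borel, gen 21); crux 14079 untouched.
-/
import Mathlib
import Summits.MatrixMultiplication.MatrixMultiplication.Theorems.SubgroupIdentityDesigns.Negative.SplitFunctional

/-!
# The Singer–Frobenius split: a Singer-type subgroup and its Frobenius cannot sit in two members

VALUE = THEOREM (every `p`, every `m ≥ 2`, every `ε`), NOT summit progress.

Identify `𝔽_p^m` with a finite field `F ⊇ 𝔽_p` through a basis `b` (`Module.Basis (Fin m) (ZMod p) F`;
any `F`, e.g. `GaloisField p m`).  Multiplication by units gives the SINGER CYCLE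
`mulGL b : Fˣ →* GL_m(𝔽_p)` and the Frobenius `x ↦ x^p` gives `frobGL b ∈ GL_m(𝔽_p)`.  For every
subgroup `N' ≤ Fˣ` containing all `(p-1)`-th powers (e.g. `N' = Fˣ`, or the norm-one subgroup of
order `b = (p^m-1)/(p-1)` — the window floor of the open region) the pair
`(N = mulGL b (N'), q = frobGL b)` satisfies the hypotheses of the cyclic-index functional
(`SplitFunctional.lean`): `q^i x = x^{p^i} = x^{p^i-1} · x` with `x^{p^i-1} = (x^{p-1})^{1+p+⋯}`
(TRANSLATED ACTION), and `μ_y q^i = 1 ⇒ y = μ_y q^i (1) = 1 ⇒ q^i = 1`.  Hence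
(`no_design_of_singerFrobenius₁₂/₁₃/₂₃/₂₁/₃₁/₃₂`):

**if `μ(N') ≤ H_a` and the Frobenius `frobGL b ∈ H_c` for some `a ≠ c`, then `(H₁, H₂, H₃)` carries
no level-one identity design** (any `p`, any `m`, as soon as the Frobenius is not the identity,
i.e. `F ≠ 𝔽_p`; hypothesis `hF : ∃ x : F, x^p ≠ x`).  No TPP, no volume hypothesis, no character.

This is the first Lean exclusion touching the SINGER-TYPE (`p`-free, `ℂ[V]`-full) members of the
open region: the norm-one Singer group `N_b` is a carrier (it acts semiregularly), but `N_b ⋊ ⟨φ⟩` is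
not, and the obstruction survives distributing `N_b` and `φ` over two members.  GAP cross-check:
kit job j146070 (ORACLE-g21 §G21-17).

HONEST SCOPE.  Configuration exclusion; Singer-type members whose Frobenius lies in no member are
untouched; no `(p,m,ε)` cell is emptied.
-/

set_option linter.dupNamespace false

noncomputable section

open scoped BigOperators Classical Matrix

namespace Summit.MatrixMultiplication.MatrixMultiplication.Theorems.SubgroupIdentityDesigns.Negative
namespace FieldFrobenius

open Summit.MatrixMultiplication.MatrixMultiplication.Theorems.LieRankDesigns.Negative (GLm Mat)
open SplitFunctional (no_design_of_split)

variable {p m : ℕ} [hp : Fact p.Prime]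
variable {F : Type*} [Field F] [Fintype F] [Algebra (ZMod p) F]
  (b : Module.Basis (Fin m) (ZMod p) F)

/-! ## The Singer cycle in coordinates -/

/-- Multiplication by units of `F`, in the coordinates of `b`: the Singer cycle `Fˣ →* GL_m(𝔽_p)`. -/
def mulGL : Fˣ →* GLm p m :=
  Units.map ((Algebra.leftMulMatrix b : F →ₐ[ZMod p] Mat p m) : F →* Mat p m)

omit [Fintype F] in
/-- The matrix of `μ_y`. -/
theorem coe_mulGL (y : Fˣ) : ((mulGL b y : GLm p m) : Mat p m) = Algebra.leftMulMatrix b (y : F) :=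
  rfl

omit [Fintype F] in
/-- `μ_y` sends the coordinates of `x` to the coordinates of `y x`. -/
theorem mulGL_mulVec (y : Fˣ) (x : F) :
    ((mulGL b y : GLm p m) : Mat p m) *ᵥ ⇑(b.repr x) = ⇑(b.repr ((y : F) * x)) := by
  rw [coe_mulGL]
  exact Algebra.leftMulMatrix_mulVec_repr b (y : F) x

omit [Fintype F] in
/-- `F` has characteristic `p`. -/
theorem charP : CharP F p :=
  charP_of_injective_algebraMap (algebraMap (ZMod p) F).injective p

/-! ## The Frobenius in coordinates -/

/-- The Frobenius `x ↦ x^p` as a `ZMod p`-linear map. -/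
def frobLin : F →ₗ[ZMod p] F where
  toFun x := x ^ p
  map_add' x y := by
    haveI := charP (p := p) (F := F)
    exact add_pow_char x y p
  map_smul' c x := by
    simp only [RingHom.id_apply, Algebra.smul_def, mul_pow, ← map_pow, ZMod.pow_card]

omit [Fintype F] in
/-- Unfolding the Frobenius map. -/
theorem frobLin_apply (x : F) : frobLin (p := p) x = x ^ p := rfl

omit [Fintype F] in
/-- Iterates of the Frobenius: `φ^i x = x^{p^i}`. -/
theorem frobLin_pow_apply (i : ℕ) (x : F) : (frobLin (p := p) ^ i) x = x ^ p ^ i := by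
  induction i generalizing x with
  | zero => simp
  | succ i ih => rw [pow_succ', Module.End.mul_apply, frobLin_apply, ih, ← pow_mul, ← pow_succ]

/-- The Frobenius matrix in the basis `b`. -/
def frobMat : Mat p m := LinearMap.toMatrix b b (frobLin (p := p))

omit [Fintype F] in
/-- `Φ^i` sends the coordinates of `x` to the coordinates of `x^{p^i}`. -/
theorem frobMat_pow_mulVec (i : ℕ) (x : F) :
    (frobMat b ^ i) *ᵥ ⇑(b.repr x) = ⇑(b.repr (x ^ p ^ i)) := by
  rw [frobMat, LinearMap.toMatrix_pow, LinearMap.toMatrix_mulVec_repr, frobLin_pow_apply]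

include b in
/-- `|F| = p^m`. -/
theorem card_F : Fintype.card F = p ^ m := by
  rw [Module.card_fintype b, ZMod.card, Fintype.card_fin]

/-- `Φ^m = 1`. -/
theorem frobMat_pow_m : frobMat b ^ m = 1 := by
  rw [frobMat, LinearMap.toMatrix_pow]
  have h : frobLin (p := p) (F := F) ^ m = 1 := by
    ext x
    rw [frobLin_pow_apply, ← card_F b, FiniteField.pow_card, Module.End.one_apply]
  rw [h, LinearMap.toMatrix_one]

/-- The Frobenius as an element of `GL_m(𝔽_p)` (for `m ≠ 0`). -/
def frobGL (hm : m ≠ 0) : GLm p m := Units.ofPowEqOne (frobMat b) m (frobMat_pow_m b) hm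

/-- The matrix of the Frobenius element. -/
theorem coe_frobGL (hm : m ≠ 0) : ((frobGL b hm : GLm p m) : Mat p m) = frobMat b := rfl

/-- The matrix of `Φ^i`. -/
theorem coe_frobGL_pow (hm : m ≠ 0) (i : ℕ) :
    ((frobGL b hm ^ i : GLm p m) : Mat p m) = frobMat b ^ i := by
  rw [Units.val_pow_eq_pow_val, coe_frobGL]

omit [Fintype F] in
/-- Coordinates: every `u : 𝔽_p^m` is `b.repr x` for `x = b.equivFun.symm u`. -/
theorem repr_symm (u : Fin m → ZMod p) : ⇑(b.repr (b.equivFun.symm u)) = u := by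
  rw [← b.equivFun_apply, LinearEquiv.apply_symm_apply]

/-! ## The hypotheses of the cyclic-index functional -/

omit [Fintype F] [Algebra (ZMod p) F] in
/-- `(p-1)(1 + p + ⋯ + p^{i-1}) + 1 = p^i`, so `(p-1)`-th powers give all `(p^i-1)`-th powers. -/
theorem pow_pow_sub_one_mem {N' : Subgroup Fˣ} (hN' : ∀ z : Fˣ, z ^ (p - 1) ∈ N') (z : Fˣ)
    (i : ℕ) : z ^ (p ^ i - 1) ∈ N' := by
  have h := geom_sum_mul_add (p - 1) i
  rw [Nat.sub_add_cancel hp.out.one_le] at h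
  have he : p ^ i - 1 = (p - 1) * ∑ j ∈ Finset.range i, p ^ j := by
    rw [mul_comm]; omega
  rw [he, pow_mul]
  exact N'.pow_mem (hN' z) _

/-- TRANSLATED ACTION: `Φ^i u = μ_y u` for some `y ∈ N'` (namely `y = x^{p^i-1}`, `u ↔ x`). -/
theorem frob_translated (hm : m ≠ 0) {N' : Subgroup Fˣ} (hN' : ∀ z : Fˣ, z ^ (p - 1) ∈ N')
    (i : ℕ) (u : Fin m → ZMod p) : ∃ n ∈ N'.map (mulGL b),
      ((frobGL b hm ^ i : GLm p m) : Mat p m) *ᵥ u = ((n : GLm p m) : Mat p m) *ᵥ u := by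
  set x : F := b.equivFun.symm u with hx_def
  have hu : u = ⇑(b.repr x) := (repr_symm b u).symm
  by_cases hx : x = 0
  · refine ⟨1, Subgroup.one_mem _, ?_⟩
    have hu0 : u = 0 := by rw [hu, hx, map_zero]; rfl
    simp [hu0]
  · set z : Fˣ := Units.mk0 x hx with hz_def
    refine ⟨mulGL b (z ^ (p ^ i - 1)), Subgroup.mem_map_of_mem _ (pow_pow_sub_one_mem hN' z i), ?_⟩
    rw [hu, coe_frobGL_pow, frobMat_pow_mulVec, mulGL_mulVec]
    congr 2
    rw [Units.val_pow_eq_pow_val, Units.val_mk0, pow_sub_one_mul (pow_ne_zero i hp.out.ne_zero)]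

/-- `μ_y Φ^i = 1` forces `Φ^i = 1` (evaluate at `1 ∈ F`: `y · 1^{p^i} = 1`), hence `i = 0` below
the order of `Φ`. -/
theorem mul_frob_pow_eq_one (hm : m ≠ 0) {N' : Subgroup Fˣ} :
    ∀ n ∈ N'.map (mulGL b), ∀ i < orderOf (frobGL b hm),
      (n : GLm p m) * frobGL b hm ^ i = 1 → i = 0 := by
  intro n hn i hi heq
  obtain ⟨y, -, rfl⟩ := Subgroup.mem_map.mp hn
  have h1 : ((mulGL b y * frobGL b hm ^ i : GLm p m) : Mat p m) *ᵥ ⇑(b.repr (1 : F)) =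
      ⇑(b.repr (1 : F)) := by rw [heq]; simp
  rw [Units.val_mul, ← Matrix.mulVec_mulVec, coe_frobGL_pow, frobMat_pow_mulVec, one_pow,
    mulGL_mulVec, mul_one] at h1
  have hy : (y : F) = 1 := b.repr.injective (DFunLike.coe_injective h1)
  have hy1 : y = 1 := Units.ext hy
  rw [hy1, map_one, one_mul] at heq
  exact Nat.eq_zero_of_dvd_of_lt (orderOf_dvd_of_pow_eq_one heq) hi

/-- The Frobenius is not the identity as soon as `F ≠ 𝔽_p`; then its order is at least `2`. -/
theorem two_le_orderOf_frobGL (hm : m ≠ 0) (hF : ∃ x : F, x ^ p ≠ x) :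
    2 ≤ orderOf (frobGL b hm) := by
  obtain ⟨x, hx⟩ := hF
  have hne : frobGL b hm ≠ 1 := by
    intro h1
    apply hx
    have h := frobMat_pow_mulVec b 1 x
    rw [pow_one, pow_one, ← coe_frobGL b hm, h1] at h
    simp only [Units.val_one, Matrix.one_mulVec] at h
    exact (b.repr.injective (DFunLike.coe_injective h)).symm
  have hpos : 0 < orderOf (frobGL b hm) := orderOf_pos _
  have hne1 : orderOf (frobGL b hm) ≠ 1 := by rwa [Ne, orderOf_eq_one_iff]
  omega

/-- `Φ μ_y = μ_{y^p} Φ` (`(y x)^p = y^p x^p`): the Frobenius normalises the Singer cycle. -/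
theorem frobGL_mul_mulGL (hm : m ≠ 0) (y : Fˣ) :
    frobGL b hm * mulGL b y = mulGL b (y ^ p) * frobGL b hm := by
  apply Units.ext
  simp only [Units.val_mul, coe_frobGL, coe_mulGL, frobMat, Algebra.leftMulMatrix_apply,
    ← LinearMap.toMatrix_mul]
  congr 1
  ext x
  simp only [Module.End.mul_apply, frobLin_apply, Algebra.coe_lmul_eq_mul, LinearMap.mul_apply',
    Units.val_pow_eq_pow_val, mul_pow]

/-- `Φ⁻¹ n Φ ∈ μ(N')` for `n ∈ μ(N')` (conjugation by `Φ` is a bijection of the finite set `μ(N')`). -/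
theorem frob_inv_conj_mem (hm : m ≠ 0) (N' : Subgroup Fˣ) :
    ∀ n ∈ N'.map (mulGL b), (frobGL b hm)⁻¹ * n * frobGL b hm ∈ N'.map (mulGL b) := by
  set N := N'.map (mulGL b) with hN_def
  have hfwd : ∀ n ∈ N, frobGL b hm * n * (frobGL b hm)⁻¹ ∈ N := by
    intro n hn
    obtain ⟨y, hy, rfl⟩ := Subgroup.mem_map.mp hn
    rw [frobGL_mul_mulGL, mul_inv_cancel_right]
    exact Subgroup.mem_map_of_mem _ (N'.pow_mem hy p)
  -- conjugation by Φ maps N into N injectively, hence onto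
  set c : N → N := fun n => ⟨frobGL b hm * n * (frobGL b hm)⁻¹, hfwd n n.2⟩ with hc_def
  have hinj : Function.Injective c := by
    intro n₁ n₂ h
    have h' := congrArg Subtype.val h
    simp only [hc_def] at h'
    exact Subtype.ext (by simpa using h')
  have hsurj : Function.Surjective c := Finite.surjective_of_injective hinj
  intro n hn
  obtain ⟨n₀, hn₀⟩ := hsurj ⟨n, hn⟩
  have h' := congrArg Subtype.val hn₀
  simp only [hc_def] at h'
  have : (frobGL b hm)⁻¹ * n * frobGL b hm = n₀ := by rw [← h']; group
  rw [this]
  exact n₀.2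

/-! ## The exclusions -/

variable {H₁ H₂ H₃ : Subgroup (GLm p m)}

/-- Shared core: any cover of the `μ_y Φ^i ≠ 1` (`y ∈ N'`) by `H₁ H₂ H₃` excludes a design. -/
theorem no_design_of_cover (hm : m ≠ 0) (hF : ∃ x : F, x ^ p ≠ x) {N' : Subgroup Fˣ}
    (hN' : ∀ z : Fˣ, z ^ (p - 1) ∈ N')
    (hcov : ∀ n ∈ N'.map (mulGL b), ∀ i < orderOf (frobGL b hm),
      (n : GLm p m) * frobGL b hm ^ i ≠ 1 →
        ∃ a ∈ H₁, ∃ b' ∈ H₂, ∃ c ∈ H₃, a * b' * c = n * frobGL b hm ^ i) :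
    ¬ ∃ c : Mat p m → ℂ, (∀ M, 1 < M.rank → c M = 0) ∧
      (∑ M, c M * ZMod.stdAddChar (Matrix.trace (M * ((1 : GLm p m) : Mat p m)))) = 1 ∧
      ∀ a ∈ H₁, ∀ b ∈ H₂, ∀ g ∈ H₃, a * b * g ≠ 1 →
        (∑ M, c M * ZMod.stdAddChar (Matrix.trace (M * ((a * b * g : GLm p m) : Mat p m)))) = 0 :=
  no_design_of_split (N'.map (mulGL b)) (frobGL b hm) (two_le_orderOf_frobGL b hm hF)
    (mul_frob_pow_eq_one b hm) (fun i _ u => frob_translated b hm hN' i u) hcov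

/-- **SINGER–FROBENIUS SPLIT `(1,2)`**: `μ(N') ≤ H₁`, Frobenius in `H₂` ⇒ no level-one design. -/
theorem no_design_of_singerFrobenius₁₂ (hm : m ≠ 0) (hF : ∃ x : F, x ^ p ≠ x)
    {N' : Subgroup Fˣ} (hN' : ∀ z : Fˣ, z ^ (p - 1) ∈ N')
    (h₁ : ∀ z ∈ N', mulGL b z ∈ H₁) (h₂ : frobGL b hm ∈ H₂) :
    ¬ ∃ c : Mat p m → ℂ, (∀ M, 1 < M.rank → c M = 0) ∧
      (∑ M, c M * ZMod.stdAddChar (Matrix.trace (M * ((1 : GLm p m) : Mat p m)))) = 1 ∧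
      ∀ a ∈ H₁, ∀ b ∈ H₂, ∀ g ∈ H₃, a * b * g ≠ 1 →
        (∑ M, c M * ZMod.stdAddChar (Matrix.trace (M * ((a * b * g : GLm p m) : Mat p m)))) = 0 := by
  refine no_design_of_cover b hm hF hN' fun n hn i _ _ => ?_
  obtain ⟨y, hy, rfl⟩ := Subgroup.mem_map.mp hn
  exact ⟨_, h₁ y hy, _, H₂.pow_mem h₂ i, 1, H₃.one_mem, mul_one _⟩

/-- **`(1,3)`**: `μ(N') ≤ H₁`, Frobenius in `H₃`. -/
theorem no_design_of_singerFrobenius₁₃ (hm : m ≠ 0) (hF : ∃ x : F, x ^ p ≠ x)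
    {N' : Subgroup Fˣ} (hN' : ∀ z : Fˣ, z ^ (p - 1) ∈ N')
    (h₁ : ∀ z ∈ N', mulGL b z ∈ H₁) (h₃ : frobGL b hm ∈ H₃) :
    ¬ ∃ c : Mat p m → ℂ, (∀ M, 1 < M.rank → c M = 0) ∧
      (∑ M, c M * ZMod.stdAddChar (Matrix.trace (M * ((1 : GLm p m) : Mat p m)))) = 1 ∧
      ∀ a ∈ H₁, ∀ b ∈ H₂, ∀ g ∈ H₃, a * b * g ≠ 1 →
        (∑ M, c M * ZMod.stdAddChar (Matrix.trace (M * ((a * b * g : GLm p m) : Mat p m)))) = 0 := by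
  refine no_design_of_cover b hm hF hN' fun n hn i _ _ => ?_
  obtain ⟨y, hy, rfl⟩ := Subgroup.mem_map.mp hn
  exact ⟨_, h₁ y hy, 1, H₂.one_mem, _, H₃.pow_mem h₃ i, by rw [mul_one]⟩

/-- **`(2,3)`**: `μ(N') ≤ H₂`, Frobenius in `H₃`. -/
theorem no_design_of_singerFrobenius₂₃ (hm : m ≠ 0) (hF : ∃ x : F, x ^ p ≠ x)
    {N' : Subgroup Fˣ} (hN' : ∀ z : Fˣ, z ^ (p - 1) ∈ N')
    (h₂ : ∀ z ∈ N', mulGL b z ∈ H₂) (h₃ : frobGL b hm ∈ H₃) :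
    ¬ ∃ c : Mat p m → ℂ, (∀ M, 1 < M.rank → c M = 0) ∧
      (∑ M, c M * ZMod.stdAddChar (Matrix.trace (M * ((1 : GLm p m) : Mat p m)))) = 1 ∧
      ∀ a ∈ H₁, ∀ b ∈ H₂, ∀ g ∈ H₃, a * b * g ≠ 1 →
        (∑ M, c M * ZMod.stdAddChar (Matrix.trace (M * ((a * b * g : GLm p m) : Mat p m)))) = 0 := by
  refine no_design_of_cover b hm hF hN' fun n hn i _ _ => ?_
  obtain ⟨y, hy, rfl⟩ := Subgroup.mem_map.mp hn
  exact ⟨1, H₁.one_mem, _, h₂ y hy, _, H₃.pow_mem h₃ i, by rw [one_mul]⟩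

/-- **`(2,1)`**: Frobenius in `H₁`, `μ(N') ≤ H₂` (reorder `n Φ^i = Φ^i · Φ^{-i} n Φ^i`). -/
theorem no_design_of_singerFrobenius₂₁ (hm : m ≠ 0) (hF : ∃ x : F, x ^ p ≠ x)
    {N' : Subgroup Fˣ} (hN' : ∀ z : Fˣ, z ^ (p - 1) ∈ N')
    (h₁ : frobGL b hm ∈ H₁) (h₂ : ∀ z ∈ N', mulGL b z ∈ H₂) :
    ¬ ∃ c : Mat p m → ℂ, (∀ M, 1 < M.rank → c M = 0) ∧
      (∑ M, c M * ZMod.stdAddChar (Matrix.trace (M * ((1 : GLm p m) : Mat p m)))) = 1 ∧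
      ∀ a ∈ H₁, ∀ b ∈ H₂, ∀ g ∈ H₃, a * b * g ≠ 1 →
        (∑ M, c M * ZMod.stdAddChar (Matrix.trace (M * ((a * b * g : GLm p m) : Mat p m)))) = 0 := by
  have hle : N'.map (mulGL b) ≤ H₂ := Subgroup.map_le_iff_le_comap.mpr fun z hz => h₂ z hz
  refine no_design_of_cover b hm hF hN' fun n hn i _ _ => ?_
  exact ⟨_, H₁.pow_mem h₁ i, _,
    hle (SplitFunctional.conj_pow_mem (frob_inv_conj_mem b hm N') hn i), 1, H₃.one_mem, by group⟩

/-- **`(3,1)`**: Frobenius in `H₁`, `μ(N') ≤ H₃`. -/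
theorem no_design_of_singerFrobenius₃₁ (hm : m ≠ 0) (hF : ∃ x : F, x ^ p ≠ x)
    {N' : Subgroup Fˣ} (hN' : ∀ z : Fˣ, z ^ (p - 1) ∈ N')
    (h₁ : frobGL b hm ∈ H₁) (h₃ : ∀ z ∈ N', mulGL b z ∈ H₃) :
    ¬ ∃ c : Mat p m → ℂ, (∀ M, 1 < M.rank → c M = 0) ∧
      (∑ M, c M * ZMod.stdAddChar (Matrix.trace (M * ((1 : GLm p m) : Mat p m)))) = 1 ∧
      ∀ a ∈ H₁, ∀ b ∈ H₂, ∀ g ∈ H₃, a * b * g ≠ 1 →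
        (∑ M, c M * ZMod.stdAddChar (Matrix.trace (M * ((a * b * g : GLm p m) : Mat p m)))) = 0 := by
  have hle : N'.map (mulGL b) ≤ H₃ := Subgroup.map_le_iff_le_comap.mpr fun z hz => h₃ z hz
  refine no_design_of_cover b hm hF hN' fun n hn i _ _ => ?_
  exact ⟨_, H₁.pow_mem h₁ i, 1, H₂.one_mem, _,
    hle (SplitFunctional.conj_pow_mem (frob_inv_conj_mem b hm N') hn i), by group⟩

/-- **`(3,2)`**: Frobenius in `H₂`, `μ(N') ≤ H₃`. -/
theorem no_design_of_singerFrobenius₃₂ (hm : m ≠ 0) (hF : ∃ x : F, x ^ p ≠ x)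
    {N' : Subgroup Fˣ} (hN' : ∀ z : Fˣ, z ^ (p - 1) ∈ N')
    (h₂ : frobGL b hm ∈ H₂) (h₃ : ∀ z ∈ N', mulGL b z ∈ H₃) :
    ¬ ∃ c : Mat p m → ℂ, (∀ M, 1 < M.rank → c M = 0) ∧
      (∑ M, c M * ZMod.stdAddChar (Matrix.trace (M * ((1 : GLm p m) : Mat p m)))) = 1 ∧
      ∀ a ∈ H₁, ∀ b ∈ H₂, ∀ g ∈ H₃, a * b * g ≠ 1 →
        (∑ M, c M * ZMod.stdAddChar (Matrix.trace (M * ((a * b * g : GLm p m) : Mat p m)))) = 0 := by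
  have hle : N'.map (mulGL b) ≤ H₃ := Subgroup.map_le_iff_le_comap.mpr fun z hz => h₃ z hz
  refine no_design_of_cover b hm hF hN' fun n hn i _ _ => ?_
  exact ⟨1, H₁.one_mem, _, H₂.pow_mem h₂ i, _,
    hle (SplitFunctional.conj_pow_mem (frob_inv_conj_mem b hm N') hn i), by group⟩

end FieldFrobenius
end Summit.MatrixMultiplication.MatrixMultiplication.Theorems.SubgroupIdentityDesigns.Negative
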